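import Literature.AnabelianGeometry.EtaleTheta.Discharge.Sec2IsoLift
import Literature.AnabelianGeometry.EtaleTheta.Discharge.Sec2AutOverProofs
import Literature.AnabelianGeometry.EtaleTheta.Discharge.Sec2ShiftNormalizesDY

/-!
# [EtTh] Remark 2.19.2: cyclotomic rigidity fails for `M`-th powers of the `l`-th root of the theta
# function — the "power" mono-theta environments and their extra automorphisms

Mochizuki, *The Étale Theta Function and its Frobenioid-theoretic Manifestations* [EtTh],
Publ. RIMS 45 (2009), §2, Remark 2.19.2, PRIMS text p.67 (printed 293) (locator `p.N` = PDF page;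
bib key `MochizukiEtTh2009`). Seat abc-iut-L2-t2 (typer/owner of [EtTh] §2); until now the node
`EtTh:Rmk2.19.2` was a documentation paragraph of `ThetaRigidity.lean`. Cited by [IUTchII]/[IUTchIII]
as the reason mono-theta environments are built from the FIRST power of the `l`-th root.

PRINT (p.67): "The 'cyclotomic rigidity' of Corollary 2.19, (i), is a consequence of the theta section
portion of the data that constitutes a mono-theta environment … This subtle property fails to hold if
instead of considering `η̲̈^{Θ,l·ℤ×μ₂}` over `Ÿ̲̲` — i.e., the first power of an `l`-th root of the theta
function … — one attempts to use some `M`-th power of the `l`-th root of the theta function for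
`M > 1`. Put another way, if one tries to work with such an `M`-th power, where `M > 1`, then one ends
up only being able to assert the desired 'cyclotomic rigidity' for the submodule `M·μ_N ⊆ μ_N` [for,
say, `N` divisible by `M`]; that is to say, the 'remainder' of `μ_N` is not rigid, but rather subject
to an indeterminacy with respect to the action of `Ker((ℤ/Nℤ)^× ↠ (ℤ/(N/M)ℤ)^×)`."

TYPED over the interface `ThetaEnvData N` of `MonoThetaEnv.lean` (seat abc-iut-L2-t2), and PROVED
(no named fact):

* `ThetaEnvData.powTheta m hη` — the section `g ↦ (η(g)^M)⁻¹ · s^alg(g)` of `Π^tp_Y[μ_N] ↠ Π^tp_Y` over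
  `Π^tp_Ÿ` attached to the `M`-th power of the theta cocycle `η` ("an `M`-th power of the `l`-th root
  of the theta function"), and `ThetaEnvData.powMono m hη` — the resulting data
  `(Π^tp_Y[μ_N], D_Y, [Im s_{η^M}])` (Def 2.13 (ii) with `η` replaced by `η^M`); `powMono 1 hη` is the
  model mono-theta environment (`powMono_one`);
* `ThetaEnvData.sAlg_mul_powTheta_inv` — the relation between the two sections sees only
  `η(g)^M ∈ M·μ_N` ("cyclotomic rigidity for the submodule `M·μ_N`");
* `ThetaEnvData.powAut` — for `λ` invertible modulo `N`, the automorphism `(a, g) ↦ (a^λ, g)` of the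
  topological group `Π^tp_Y[μ_N]`; it NORMALISES `D_Y` (`map_DY_powAut`: it conjugates the Kummer shift
  `α_δ` to `α_{δ^λ}` and commutes with the `Gal(Y/X)`-conjugations), induces the identity on `Π^tp_Y`,
  and acts on the cyclotome `μ_N` by `λ`;
* `ThetaEnvData.exists_iso_powMono` — **Rmk 2.19.2**: whenever `a^{Mλ} = a^M` on `μ_N` (i.e. `λ`
  reduces to `1` in `(ℤ/(N/M)ℤ)^×` for `M ∣ N`), `powAut λ` is an AUTOMORPHISM of `powMono m hη` acting
  on `μ_N` by the (in general nontrivial) element `λ` of `Ker((ℤ/Nℤ)^× ↠ (ℤ/(N/M)ℤ)^×)` — the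
  "indeterminacy" of print; `exists_iso_powMono_of_coprime` derives the inverse exponent from
  `λ.Coprime N`.

HONEST FRAMING: [EtTh] is refereed; this file proves elementary group theory about the model data; no
side is taken on [IUTchIII] Cor 3.12; typed ≠ discharged elsewhere.
-/

noncomputable section

namespace Literature.AnabelianGeometry.EtaleTheta

universe u

/-! ## Powers of cocycles -/

namespace CycEnvelope

variable {P G μ : Type*} [Group P] [Group G] [CommGroup μ] {aug : P →* G} {χ : G →* MulAut μ}

/-- A power of a 1-cocycle is a 1-cocycle (`μ_N` commutative, `G_K` acting by automorphisms).
[cite: MochizukiEtTh2009, Prop 2.14(ii) p.49] -/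
theorem IsEnvCocycle.pow {δ : P → μ} (hδ : IsEnvCocycle aug χ δ) (m : ℕ) : IsEnvCocycle aug χ (δ ^ m) := by
  intro g h
  simp only [Pi.pow_apply, hδ g h, mul_pow, map_pow]

end CycEnvelope

namespace ThetaEnvData

variable {N : ℕ+} (T : ThetaEnvData.{u} N)

/-! ## The section attached to the `M`-th power of the theta cocycle -/

/-- **"An `M`-th power of the `l`-th root of the theta function"** as a section of
`Π^tp_Y[μ_N] ↠ Π^tp_Y` over `Π^tp_Ÿ`: `g ↦ (η(g)^M)⁻¹ · s^alg(g)` — Def 2.13 (i)'s "`s^Θ_Ÿ` obtained by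
subtracting `η`", with `η` replaced by `η^M`. [cite: MochizukiEtTh2009, Rmk 2.19.2 p.67] -/
def powTheta (m : ℕ) {η : T.PiYdd → T.mu} (hη : η ∈ T.thetaCocycles) : T.PiYdd →* T.env where
  toFun g := ⟨((η g) ^ m)⁻¹, T.inclYdd g⟩
  map_one' := by
    have h1 : η 1 = 1 := by
      have := T.isCocycle η hη 1 1
      simp only [mul_one, map_one, MulAut.one_apply] at this
      exact mul_eq_left.mp this.symm
    refine SemidirectProduct.ext ?_ ?_
    · show ((η 1) ^ m)⁻¹ = 1
      rw [h1, one_pow, inv_one]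
    · show T.inclYdd 1 = 1
      exact map_one _
  map_mul' g h := by
    have hc := (T.isCocycle η hη).pow m g h
    simp only [Pi.pow_apply] at hc
    refine SemidirectProduct.ext ?_ ?_
    · show ((η (g * h)) ^ m)⁻¹ = ((η g) ^ m)⁻¹ * (T.chi.comp T.augY) (T.inclYdd g) (((η h) ^ m)⁻¹)
      rw [hc, mul_inv_rev, map_inv, mul_comm]
      rfl
    · show T.inclYdd (g * h) = T.inclYdd g * T.inclYdd h
      exact map_mul _ _ _

/-- `powTheta` evaluated. [cite: MochizukiEtTh2009, Rmk 2.19.2 p.67] -/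
@[simp] theorem powTheta_apply (m : ℕ) {η : T.PiYdd → T.mu} (hη : η ∈ T.thetaCocycles) (g : T.PiYdd) :
    T.powTheta m hη g = ⟨((η g) ^ m)⁻¹, T.inclYdd g⟩ := rfl

/-- The first power is the theta section of Def 2.13 (i). [cite: MochizukiEtTh2009, Rmk 2.19.2 p.67] -/
theorem powTheta_one {η : T.PiYdd → T.mu} (hη : η ∈ T.thetaCocycles) : T.powTheta 1 hη = T.sTheta hη :=
  MonoidHom.ext fun g => SemidirectProduct.ext (by show ((η g) ^ 1)⁻¹ = (η g)⁻¹; rw [pow_one]) rfl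

/-- **The data `(Π^tp_Y[μ_N], D_Y, [Im s_{η^M}])`** obtained by "working with an `M`-th power of the
`l`-th root of the theta function" (Def 2.13 (ii) with `η^M` for `η`).
[cite: MochizukiEtTh2009, Rmk 2.19.2 p.67] -/
abbrev powMono (m : ℕ) {η : T.PiYdd → T.mu} (hη : η ∈ T.thetaCocycles) : MonoThetaEnv.{u} where
  Pi := T.env
  D := T.DY
  sTheta := CycEnvelope.muConjClass T.augY T.chi (T.powTheta m hη).range

/-- `powMono 1` is the model mono-theta environment of Def 2.13 (ii).
[cite: MochizukiEtTh2009, Rmk 2.19.2 p.67] -/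
theorem powMono_one {η : T.PiYdd → T.mu} (hη : η ∈ T.thetaCocycles) : T.powMono 1 hη = T.modelMono hη := by
  simp only [powMono, modelMono, powTheta_one]

/-- **"Cyclotomic rigidity for the submodule `M·μ_N`"**: comparing the algebraic section with the
`M`-th-power theta section at `g ∈ Π^tp_Ÿ` recovers only `η(g)^M ∈ M·μ_N` (for `g` over `l·Δ_Θ`,
`η(g)` is the image of `g` under `(l·Δ_Θ) ↠ μ_N`, Cor 2.19 (i); here the `M`-th power of it).
[cite: MochizukiEtTh2009, Rmk 2.19.2 p.67] -/
theorem sAlg_mul_powTheta_inv (m : ℕ) {η : T.PiYdd → T.mu} (hη : η ∈ T.thetaCocycles) (g : T.PiYdd) :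
    T.sAlg g * (T.powTheta m hη g)⁻¹ = CycEnvelope.inMu T.augY T.chi ((η g) ^ m) := by
  rw [mul_inv_eq_iff_eq_mul]
  refine SemidirectProduct.ext ?_ ?_
  · show (1 : T.mu) = (η g) ^ m * (T.chi.comp T.augY) 1 (((η g) ^ m)⁻¹)
    rw [map_one, MulAut.one_apply, mul_inv_cancel]
  · show T.inclYdd g = 1 * T.inclYdd g
    rw [one_mul]

/-- The image of `s_{η^M}` lies in `M·μ_N · Im(s^alg)`: every value is an `M`-th power of the cyclotome
times the algebraic section. [cite: MochizukiEtTh2009, Rmk 2.19.2 p.67] -/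
theorem powTheta_mem_pow_mul_sAlg (m : ℕ) {η : T.PiYdd → T.mu} (hη : η ∈ T.thetaCocycles) (g : T.PiYdd) :
    ∃ a : T.mu, T.powTheta m hη g = CycEnvelope.inMu T.augY T.chi (a ^ m) * T.sAlg g := by
  refine ⟨(η g)⁻¹, SemidirectProduct.ext ?_ ?_⟩
  · show ((η g) ^ m)⁻¹ = (η g)⁻¹ ^ m * (T.chi.comp T.augY) 1 1
    simp only [map_one, mul_one, inv_pow]
  · show T.inclYdd g = 1 * T.inclYdd g
    rw [one_mul]

/-! ## The power automorphisms of `Π^tp_Y[μ_N]` -/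

section PowAut

variable (n n' : ℕ) (hinv : ∀ a : T.mu, (a ^ n) ^ n' = a) (hinv' : ∀ a : T.mu, (a ^ n') ^ n = a)

/-- Raising the cyclotome to the `λ`-th power, `(a, g) ↦ (a^λ, g)`, is an endomorphism of
`Π^tp_Y[μ_N] = μ_N ⋊ Π^tp_Y` (the action of `Π^tp_Y` on `μ_N` is by group automorphisms).
[cite: MochizukiEtTh2009, Rmk 2.19.2 p.67] -/
def powEnd (n : ℕ) : T.env →* T.env where
  toFun x := ⟨x.left ^ n, x.right⟩
  map_one' := SemidirectProduct.ext (one_pow n) rfl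
  map_mul' x y := by
    refine SemidirectProduct.ext ?_ rfl
    show (x.left * (T.chi.comp T.augY) x.right y.left) ^ n =
      x.left ^ n * (T.chi.comp T.augY) x.right (y.left ^ n)
    rw [mul_pow, map_pow]

/-- `powEnd` evaluated. [cite: MochizukiEtTh2009, Rmk 2.19.2 p.67] -/
@[simp] theorem powEnd_apply (n : ℕ) (x : T.env) : T.powEnd n x = ⟨x.left ^ n, x.right⟩ := rfl

/-- `powEnd` is continuous (`μ_N` discrete). [cite: MochizukiEtTh2009, Rmk 2.19.2 p.67] -/
theorem continuous_powEnd (n : ℕ) : Continuous (T.powEnd n) :=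
  T.continuous_env_mk (continuous_of_discreteTopology.comp T.continuous_left) T.continuous_right

variable {n n'}

/-- **The power automorphism** `(a, g) ↦ (a^λ, g)` of the TOPOLOGICAL group `Π^tp_Y[μ_N]`, for `λ`
invertible modulo `N` (`λ'` an inverse exponent on `μ_N`). [cite: MochizukiEtTh2009, Rmk 2.19.2 p.67] -/
def powAut (hinv : ∀ a : T.mu, (a ^ n) ^ n' = a) (hinv' : ∀ a : T.mu, (a ^ n') ^ n = a) :
    T.env ≃ₜ* T.env where
  toFun := T.powEnd n
  invFun := T.powEnd n'
  left_inv x := SemidirectProduct.ext (hinv x.left) rfl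
  right_inv x := SemidirectProduct.ext (hinv' x.left) rfl
  map_mul' := map_mul _
  continuous_toFun := T.continuous_powEnd n
  continuous_invFun := T.continuous_powEnd n'

/-- `powAut` evaluated. [cite: MochizukiEtTh2009, Rmk 2.19.2 p.67] -/
@[simp] theorem powAut_apply (x : T.env) : T.powAut hinv hinv' x = ⟨x.left ^ n, x.right⟩ := rfl

/-- The inverse of `powAut`. [cite: MochizukiEtTh2009, Rmk 2.19.2 p.67] -/
@[simp] theorem powAut_symm_apply (x : T.env) : (T.powAut hinv hinv').symm x = ⟨x.left ^ n', x.right⟩ :=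
  rfl

/-- `powAut λ` acts on the cyclotome `μ_N` by `λ`. [cite: MochizukiEtTh2009, Rmk 2.19.2 p.67] -/
theorem powAut_inMu (a : T.mu) :
    T.powAut hinv hinv' (CycEnvelope.inMu T.augY T.chi a) = CycEnvelope.inMu T.augY T.chi (a ^ n) :=
  SemidirectProduct.ext rfl rfl

/-- `powAut λ` induces the identity on `Π^tp_Y`. [cite: MochizukiEtTh2009, Rmk 2.19.2 p.67] -/
theorem proj_powAut (x : T.env) :
    CycEnvelope.proj T.augY T.chi (T.powAut hinv hinv' x) = CycEnvelope.proj T.augY T.chi x := rfl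

/-- `powAut λ` fixes the algebraic section. [cite: MochizukiEtTh2009, Rmk 2.19.2 p.67] -/
theorem powAut_sAlg (g : T.PiYdd) : T.powAut hinv hinv' (T.sAlg g) = T.sAlg g :=
  SemidirectProduct.ext (one_pow n) rfl

/-- `powAut λ` carries `s_{η^M}` to `s_{η^{Mλ}}`; so it FIXES `s_{η^M}` as soon as `a^{Mλ} = a^M` on
`μ_N`. [cite: MochizukiEtTh2009, Rmk 2.19.2 p.67] -/
theorem powAut_powTheta (m : ℕ) {η : T.PiYdd → T.mu} (hη : η ∈ T.thetaCocycles)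
    (hm : ∀ a : T.mu, (a ^ m) ^ n = a ^ m) (g : T.PiYdd) :
    T.powAut hinv hinv' (T.powTheta m hη g) = T.powTheta m hη g :=
  SemidirectProduct.ext (by show (((η g) ^ m)⁻¹) ^ n = ((η g) ^ m)⁻¹; rw [inv_pow, hm]) rfl

/-- `powAut λ` conjugates the Kummer shift by `δ` to the shift by `δ^λ`:
`powAut ∘ α_δ ∘ powAut⁻¹ = α_{δ^λ}`. [cite: MochizukiEtTh2009, Rmk 2.19.2 p.67] -/
theorem powAut_shift_symm {δ : T.PiY → T.mu} (hδ : CycEnvelope.IsEnvCocycle T.augY T.chi δ) (x : T.env) :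
    T.powAut hinv hinv' (CycEnvelope.shift hδ ((T.powAut hinv hinv').symm x)) =
      CycEnvelope.shift (hδ.pow n) x :=
  SemidirectProduct.ext
    (by show (x.left ^ n' * δ x.right) ^ n = x.left * (δ ^ n) x.right; rw [mul_pow, hinv', Pi.pow_apply])
    rfl

/-- `powAut λ` commutes with the `Gal(Y/X)`-conjugations `conjX g` (the cyclotomic character acts by
group automorphisms, which commute with powers). [cite: MochizukiEtTh2009, Rmk 2.19.2 p.67] -/
theorem powAut_conjX_symm (g : T.PiX) (x : T.env) :
    T.powAut hinv hinv' (T.conjX g ((T.powAut hinv hinv').symm x)) = T.conjX g x :=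
  SemidirectProduct.ext
    (by show (T.chi (T.aug g) (x.left ^ n')) ^ n = T.chi (T.aug g) x.left; rw [← map_pow, hinv']) rfl

/-- A Kummer shift `α_δ` that is bi-continuous has a continuous cocycle `δ`
(`δ(g) = (α_δ (1, g)).left`). [cite: MochizukiEtTh2009, Def 2.13(i) p.47] -/
theorem continuous_of_shift_mem {δ : T.PiY → T.mu} (hδ : CycEnvelope.IsEnvCocycle T.augY T.chi δ)
    (hc : CycEnvelope.shift hδ ∈ contMulAut T.env) : Continuous δ := by
  have h : δ = (fun x : T.env => x.left) ∘ (CycEnvelope.shift hδ) ∘ (CycEnvelope.algSection T.augY T.chi) := by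
    funext g
    show δ g = 1 * δ g
    rw [one_mul]
  rw [h]
  exact T.continuous_left.comp (hc.1.comp T.continuous_algSection)

/-- **`powAut λ` normalises `D_Y`**: transport along it maps the Kummer generators to Kummer
generators (`[α_δ] ↦ [α_{δ^λ}]`) and fixes the `Gal(Y/X)` generators, hence maps
`D_Y = ⟨Kummer, Gal(Y/X)⟩` onto itself. [cite: MochizukiEtTh2009, Rmk 2.19.2 p.67] -/
theorem map_DY_powAut : T.DY.map (TopOut.transport (T.powAut hinv hinv')) = T.DY := by
  -- images of the two generating sets
  have hK : ∀ {k k' : ℕ} (hi : ∀ a : T.mu, (a ^ k) ^ k' = a) (hi' : ∀ a : T.mu, (a ^ k') ^ k = a),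
      TopOut.transport (T.powAut hi hi') '' T.kummerOut ⊆ T.kummerOut := by
    intro k k' hi hi'
    rintro _ ⟨_, ⟨δ₀, hδ, hc, rfl⟩, rfl⟩
    have hcont : Continuous ((δ₀ ∘ T.augY) ^ k) :=
      (continuous_pow k).comp (T.continuous_of_shift_mem hδ hc)
    refine ⟨δ₀ ^ k, hδ.pow k, T.shift_mem_contMulAut_of_continuous (hδ.pow k) hcont, ?_⟩
    rw [transport_mk]
    congr 1
    apply Subtype.ext
    apply MulEquiv.ext
    intro x
    rw [conjContAut_apply]
    exact T.powAut_shift_symm hi hi' hδ x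
  have hG : ∀ {k k' : ℕ} (hi : ∀ a : T.mu, (a ^ k) ^ k' = a) (hi' : ∀ a : T.mu, (a ^ k') ^ k = a),
      TopOut.transport (T.powAut hi hi') '' T.galOut ⊆ T.galOut := by
    intro k k' hi hi'
    rintro _ ⟨_, ⟨g, hc, rfl⟩, rfl⟩
    refine ⟨g, hc, ?_⟩
    rw [transport_mk]
    congr 1
    apply Subtype.ext
    apply MulEquiv.ext
    intro x
    rw [conjContAut_apply]
    exact T.powAut_conjX_symm hi hi' g x
  -- transport along `powAut λ'` is the inverse of transport along `powAut λ`
  have hsymm : ∀ d, TopOut.transport (T.powAut hinv hinv') (TopOut.transport (T.powAut hinv' hinv) d) = d := by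
    intro d
    obtain ⟨φ, rfl⟩ := QuotientGroup.mk'_surjective _ d
    change TopOut.transport _ (TopOut.transport _ (TopOut.mk _ φ)) = TopOut.mk _ φ
    rw [transport_mk, transport_mk]
    congr 1
    apply Subtype.ext
    apply MulEquiv.ext
    intro x
    rw [conjContAut_apply, conjContAut_apply]
    change T.powAut hinv hinv' (T.powAut hinv' hinv ((φ : MulAut T.env)
      ((T.powAut hinv' hinv).symm ((T.powAut hinv hinv').symm x)))) = _
    have h1 : (T.powAut hinv' hinv).symm ((T.powAut hinv hinv').symm x) = x :=
      SemidirectProduct.ext (hinv' x.left) rfl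
    rw [h1]
    exact SemidirectProduct.ext (hinv' _) rfl
  have hgen : TopOut.transport (T.powAut hinv hinv') '' (T.kummerOut ∪ T.galOut) = T.kummerOut ∪ T.galOut := by
    apply Set.Subset.antisymm
    · rw [Set.image_union]
      exact Set.union_subset_union (hK hinv hinv') (hG hinv hinv')
    · intro d hd
      refine ⟨TopOut.transport (T.powAut hinv' hinv) d, ?_, hsymm d⟩
      rcases hd with hd | hd
      · exact Or.inl (hK hinv' hinv ⟨d, hd, rfl⟩)
      · exact Or.inr (hG hinv' hinv ⟨d, hd, rfl⟩)
  rw [ThetaEnvData.DY, MonoidHom.map_closure, hgen]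

/-- **Remark 2.19.2** ("the 'remainder' of `μ_N` is not rigid, but rather subject to an indeterminacy
with respect to the action of `Ker((ℤ/Nℤ)^× ↠ (ℤ/(N/M)ℤ)^×)`"): for every `λ` invertible modulo `N`
(inverse exponent `λ'`) with `a^{Mλ} = a^M` on `μ_N` — i.e. `λ ↦ 1` in `(ℤ/(N/M)ℤ)^×` when `M ∣ N` —
the power automorphism `powAut λ` is an AUTOMORPHISM of the data `powMono M η =
(Π^tp_Y[μ_N], D_Y, [Im s_{η^M}])` which acts on the cyclotome `μ_N` by `a ↦ a^λ` and induces the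
identity on `Π^tp_Y`. (For `M = 1` the hypothesis forces `λ ≡ 1`: the genuine mono-theta environment
admits no such indeterminacy, Cor 2.19 (i).) [cite: MochizukiEtTh2009, Rmk 2.19.2 p.67] -/
theorem exists_iso_powMono (m : ℕ) {η : T.PiYdd → T.mu} (hη : η ∈ T.thetaCocycles)
    (hm : ∀ a : T.mu, (a ^ m) ^ n = a ^ m) :
    ∃ α : (T.powMono m hη).Iso (T.powMono m hη),
      (∀ a : T.mu, α.e (CycEnvelope.inMu T.augY T.chi a) = CycEnvelope.inMu T.augY T.chi (a ^ n)) ∧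
      (∀ x : T.env, CycEnvelope.proj T.augY T.chi (α.e x) = CycEnvelope.proj T.augY T.chi x) ∧
      ∀ x : T.env, α.e x = T.powAut hinv hinv' x := by
  have hμ : ∀ a : T.mu, ∃ b : T.mu, (T.powAut hinv hinv').toMulEquiv
      (CycEnvelope.inMu T.augY T.chi a) = CycEnvelope.inMu T.augY T.chi b :=
    fun a => ⟨a ^ n, T.powAut_inMu hinv hinv' a⟩
  have hμ' : ∀ b : T.mu, ∃ a : T.mu, (T.powAut hinv hinv').toMulEquiv
      (CycEnvelope.inMu T.augY T.chi a) = CycEnvelope.inMu T.augY T.chi b :=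
    fun b => ⟨b ^ n', by
      show T.powAut hinv hinv' (CycEnvelope.inMu T.augY T.chi (b ^ n')) = _
      rw [T.powAut_inMu hinv hinv', hinv']⟩
  have hrange : (T.powTheta m hη).range.map (T.powAut hinv hinv').toMulEquiv.toMonoidHom =
      (T.powTheta m hη).range := by
    rw [MonoidHom.map_range]
    congr 1
    exact MonoidHom.ext fun g => T.powAut_powTheta hinv hinv' m hη hm g
  refine ⟨{ e := T.powAut hinv hinv', map_D := T.map_DY_powAut hinv hinv', map_sTheta := ?_ },
    fun a => T.powAut_inMu hinv hinv' a, fun x => rfl, fun x => rfl⟩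
  change (fun H : Subgroup T.env => H.map (T.powAut hinv hinv').toMulEquiv.toMonoidHom) ''
      CycEnvelope.muConjClass T.augY T.chi (T.powTheta m hη).range =
    CycEnvelope.muConjClass T.augY T.chi (T.powTheta m hη).range
  rw [CycEnvelope.image_muConjClass_eq_of_perm _ _ _ hμ hμ', hrange]

end PowAut

/-- **Remark 2.19.2, exponent form**: for `λ` coprime to `N` with `a^{Mλ} = a^M` on `μ_N` there is an
automorphism of `powMono M η` acting on `μ_N` by `λ` and trivially on `Π^tp_Y` (the inverse exponent is
supplied by `λ λ' ≡ 1 (mod N)` and `|μ_N| = N`). [cite: MochizukiEtTh2009, Rmk 2.19.2 p.67] -/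
theorem exists_iso_powMono_of_coprime (m n : ℕ) (hn : n.Coprime N) {η : T.PiYdd → T.mu}
    (hη : η ∈ T.thetaCocycles) (hm : ∀ a : T.mu, (a ^ m) ^ n = a ^ m) :
    ∃ α : (T.powMono m hη).Iso (T.powMono m hη),
      (∀ a : T.mu, α.e (CycEnvelope.inMu T.augY T.chi a) = CycEnvelope.inMu T.augY T.chi (a ^ n)) ∧
      ∀ x : T.env, CycEnvelope.proj T.augY T.chi (α.e x) = CycEnvelope.proj T.augY T.chi x := by
  -- an inverse exponent modulo `N = |μ_N|`
  obtain ⟨n', hn'⟩ : ∃ n' : ℕ, ∀ a : T.mu, (a ^ n) ^ n' = a ∧ (a ^ n') ^ n = a := by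
    set u : (ZMod N)ˣ := ZMod.unitOfCoprime n hn with hu
    refine ⟨((u⁻¹ : (ZMod N)ˣ) : ZMod N).val, fun a => ?_⟩
    have hmod : (n * ((u⁻¹ : (ZMod N)ˣ) : ZMod N).val) % N = 1 % N := by
      have h1 : ((n * ((u⁻¹ : (ZMod N)ˣ) : ZMod N).val : ℕ) : ZMod N) = 1 := by
        rw [Nat.cast_mul, ZMod.natCast_zmod_val]
        change ((u : ZMod N)) * ((u⁻¹ : (ZMod N)ˣ) : ZMod N) = 1
        rw [← Units.val_mul, mul_inv_cancel, Units.val_one]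
      have := (ZMod.natCast_eq_natCast_iff' _ 1 N).mp (by rw [h1, Nat.cast_one])
      exact this
    have hpow : ∀ k : ℕ, a ^ k = a ^ (k % N) := fun k => by
      rw [← T.card_mu]; exact pow_mod_card a k |>.symm
    have key : a ^ (n * ((u⁻¹ : (ZMod N)ˣ) : ZMod N).val) = a := by
      rw [hpow, hmod, ← hpow, pow_one]
    refine ⟨by rw [← pow_mul, key], by rw [← pow_mul, mul_comm, key]⟩
  obtain ⟨α, h1, h2, -⟩ := T.exists_iso_powMono (fun a => (hn' a).1) (fun a => (hn' a).2) m hη hm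
  exact ⟨α, h1, h2⟩

end ThetaEnvData

end Literature.AnabelianGeometry.EtaleTheta

end
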